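import Summits.BirchSwinnertonDyer.Rank1Residual.P2.CongruentNumberPairsAtTwoEvenThreePrimesDoor
import Summits.BirchSwinnertonDyer.Rank1Residual.P2.CongruentNumberEvenFiveFamilyDescent
import Literature.NumberTheory.EllipticCurves.CongruentNumberEvenMonskySelmerBound
import HarnessLib

/-!
# The uniform EVEN DOOR `n = 2p₁⋯p_k ≡ 6 (mod 8)`, `s(n) = 1`, WITHOUT Monsky's `2`-Selmer display:
# `ord_{s=1} L = 1`, rank `1`, `Ш[2^∞] = 0` and `BSD(E_n, 2) ⟺ ord₂(L′(E_n,1)/(Ω·Reg)) = 2k − 2`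
# from ANY rank-one datum, modulo GZK ONLY (the binder `hMe` of `…PairsAtTwoEvenThreePrimesDoor` discharged)

HONEST FRAMING (cell `bsd-monsky`, run/shared/lean/pub/bsd-monsky/, README §1/§3; sub-lane «bsd-p2» vocabulary): the
cell's CLAIMED theorem is Monsky's 1990 conjecture (a)+(b) on `𝒮⁻` (`k = 2`); the `k ≥ 3` rungs are a RECORD, not a
claim. The landed door `rankOne_sha_bsdp_two_iff_congruentNumberCurve_two_mul_prod`
(`P2/CongruentNumberPairsAtTwoEvenThreePrimesDoor.lean`, uniform in `k`) takes TWO named published facts: `hGZK`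
(Gross–Zagier–Kolyvagin, `rank_eq_analyticRank_of_analyticRank_le_one`) and `hMe` (Monsky's even `2`-descent matrix
theorem, `HeathBrown1994.monsky_card_selmerGroup_two_even`: `#Sel₂(E_{2p₁⋯p_k}) = 2^{2+s}`), the latter only through
`#Sel₂ = 8 ⟹ Ш[2^∞] = 0` given rank `1`. The tree now PROVES the upper-bound half of Monsky's even formula for every
`k` (`Literature/…/CongruentNumberEvenMonskySelmerBound.lean`,
`card_selmerGroup_two_le_pow_monskySelmerRankEven : #Sel₂(E_{2p₁⋯p_k}) ≤ 2^{2+s}`, complete `2`-descent on Selmer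
classes, Silverman AEC X.1.4 / X.1.5 / X.4.9), and `Ш[2^∞] = 0` needs only `#Sel₂ ≤ 8` with rank `1`
(`primaryComponent_sha_two_eq_bot_of_card_selmerGroup_le_eight`, Silverman X.4.2). HENCE THIS FILE: the same door
with `hMe` STRUCK — `rankOne_sha_bsdp_two_iff_congruentNumberCurve_two_mul_prod_descent (hGZK)` (§1, `Fin k` form) and
its `Fin 3` / `(p, q, r)` forms with the literal exponent `4` (§2). Every consumer of the old door (the cell's star family, the
𝒮⁻-towers, the `k = 3` / `k = 4` records, the census lane's even `ℓ = 3` cells) may swap doors and drop `hMe`.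
CONDITIONAL on `hGZK` only; per-pair biconditionals; nothing asserted; closes no class; no mark moved.

References: [HeathBrown1994SelmerCongruentII] Appendix (Monsky), typescript p. 41 L1–L36 (even case; here a tree
theorem, upper bound); [SilvermanAEC2009] Prop. X.1.4, Example X.1.5, Prop. X.4.9, Thm. X.4.2; [SilvermanATAEC1994]
IV.9.4, Table 4.1; [Miller2011LMS] Def. 1.1.
-/

noncomputable section

open scoped Classical

open Matrix WeierstrassCurve Literature.NumberTheory.EllipticCurves
  Literature.NumberTheory.EllipticCurves.Rank1Residual
  Literature.NumberTheory.EllipticCurves.Rank1Residual.Typed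
  Literature.NumberTheory.EllipticCurves.HeathBrown1994
  Literature.NumberTheory.EllipticCurves.TianYuanZhang2017

set_option autoImplicit false

namespace Summit.BirchSwinnertonDyer.Rank1Residual.P2

/-! ## §1 The door, uniform in `k`, modulo GZK only -/

section Door

variable {k : ℕ} (p : Fin k → ℕ)

/-- **`#Sel₂(E_n) ≤ 8` on the even family with `s(n) = 1`** — a tree theorem (Monsky's even formula, upper bound,
`card_selmerGroup_two_le_pow_monskySelmerRankEven`, at `s = 1`). Unconditional.
[cite: HeathBrown1994SelmerCongruentII, Appendix (Monsky), typescript p. 41 L20–L36]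
[cite: SilvermanAEC2009, Prop. X.1.4, Example X.1.5, Prop. X.4.9] -/
theorem card_selmerGroup_two_le_eight_of_monskySelmerRankEven_eq_one (hp : ∀ i, (p i).Prime)
    (hodd : ∀ i, Odd (p i)) (hinj : Function.Injective p) (hs : monskySelmerRankEven p = 1) :
    Nat.card ((congruentNumberCurve (2 * ∏ i, p i)).selmerGroup 2) ≤ 8 := by
  have h := card_selmerGroup_two_le_pow_monskySelmerRankEven k p hp hodd hinj
  rw [hs] at h
  exact h

/-- **THE EVEN DOOR OVER CENSUS VOCABULARY, binder `hGZK` ONLY, uniform in `k`** (the landed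
`rankOne_sha_bsdp_two_iff_congruentNumberCurve_two_mul_prod` with Monsky's `2`-Selmer display `hMe` DISCHARGED by the
tree's complete `2`-descent). For distinct primes `p₁, …, p_k` with `n = 2p₁⋯p_k ≡ 6 (mod 8)`, Monsky's even Selmer
rank `s(n) = monskySelmerRankEven p = 1`, and ANY rank-one datum `L′(E_n, 1) = x·Ω·Reg` with `x ∈ ℚ`, `x ≠ 0`:
`ord_{s=1} L(E_n, s) = 1` (root number `−1` + `x ≠ 0`, no fact), rank `1` (GZK), `Ш(E_n)[2^∞] = 0` (`#Sel₂ ≤ 2^{2+s} = 8`,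
a tree theorem, + Silverman X.4.2), and `BSD(E_n, 2) ⟺ ord₂ x = (2k + 2) − 4 = 2k − 2`. Per-pair; closes no class.
CONDITIONAL on `hGZK`; nothing asserted. [cite: HeathBrown1994SelmerCongruentII, Appendix (Monsky), typescript p. 41 L20–L36]
[cite: SilvermanAEC2009, Prop. X.1.4, Prop. X.4.9, Thm. X.4.2] [cite: SilvermanATAEC1994, IV.9.4, Table 4.1 (PDF pp. 345–347)]
[cite: Miller2011LMS, Def. 1.1 (arXiv:1010.2431 p. 3)] -/
theorem rankOne_sha_bsdp_two_iff_congruentNumberCurve_two_mul_prod_descent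
    (hGZK : rank_eq_analyticRank_of_analyticRank_le_one)
    (hp : ∀ i, (p i).Prime) (hinj : Function.Injective p) {n : ℕ} (hn : 2 * ∏ i, p i = n)
    (h8 : n % 8 = 6) (hs : monskySelmerRankEven p = 1) {x : ℚ} (hx0 : x ≠ 0)
    (hx : deriv (congruentNumberCurve n).entireLFunction 1 =
      (x : ℂ) * ((congruentNumberCurve n).realPeriodRat : ℂ) *
        ((congruentNumberCurve n).regulator : ℂ)) :
    (congruentNumberCurve n).analyticRank = 1 ∧ (congruentNumberCurve n).mordellWeilRank = 1 ∧
      AddCommGroup.primaryComponent (congruentNumberCurve n).sha 2 = ⊥ ∧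
      (BSDp (congruentNumberCurve n) 2 ↔ padicValRat 2 x = 2 * (k : ℤ) - 2) := by
  have hodd : ∀ i, Odd (p i) := odd_of_two_mul_prod_mod_eight_six p hn h8
  have hsq : Squarefree n := hn ▸ squarefree_two_mul_prod_of_injective p hp hodd hinj
  have hn0 : n ≠ 0 := hsq.ne_zero
  haveI := isElliptic_congruentNumberCurve hn0
  haveI : Fact (Nat.Prime 2) := ⟨Nat.prime_two⟩
  -- root number `−1` and `x ≠ 0`: `ord_{s=1} L = 1` (no named fact)
  have hΩ : ((congruentNumberCurve n).realPeriodRat : ℂ) ≠ 0 := by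
    exact_mod_cast (congruentNumberCurve n).realPeriodRat_pos_holds.ne'
  have hR : ((congruentNumberCurve n).regulator : ℂ) ≠ 0 := by
    exact_mod_cast (congruentNumberCurve n).regulator_pos'.ne'
  have hder : deriv (congruentNumberCurve n).entireLFunction 1 ≠ 0 := by
    rw [hx]
    exact mul_ne_zero (mul_ne_zero (by exact_mod_cast hx0) hΩ) hR
  have hr1 : (congruentNumberCurve n).analyticRank = 1 :=
    analyticRank_congruentNumberCurve_eq_one_of_deriv_ne_zero hsq (Or.inr (Or.inl h8)) hder
  -- GZK: rank `1`; the tree's `2`-descent + `s(n) = 1`: `#Sel₂ ≤ 8`; hence `Ш[2^∞] = 0`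
  obtain ⟨hrank, -⟩ := hGZK (congruentNumberCurve n) (le_of_eq hr1)
  rw [hr1] at hrank
  have hsel : Nat.card ((congruentNumberCurve n).selmerGroup 2) ≤ 8 := by
    subst hn
    exact card_selmerGroup_two_le_eight_of_monskySelmerRankEven_eq_one p hp hodd hinj hs
  have hbot := primaryComponent_sha_two_eq_bot_of_card_selmerGroup_le_eight hn0 hrank hsel
  refine ⟨hr1, hrank, hbot, ?_⟩
  rw [bsdp_two_iff_of_LDerivOverOmegaReg_of_sha_two_eq_bot_of_torsionOrder_eq_four
    (congruentNumberCurve n) hGZK hr1 hx hbot (torsionOrder_congruentNumberCurve hsq),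
    tamagawaProduct_congruentNumberCurve_two_mul_prod p hp hodd hinj hn, padicValNat.prime_pow]
  push_cast
  omega

end Door

/-! ## §2 Three primes: the literal exponent `4` -/

section ThreePrimes

/-- **THE EVEN `ℓ = 3` DOOR, `Fin 3` form, binder `hGZK` ONLY.** For distinct primes `p₀, p₁, p₂` with
`n = 2p₀p₁p₂ ≡ 6 (mod 8)`, `monskySelmerRankEven p = 1`, and ANY rank-one datum `L′(E_n, 1) = x·Ω·Reg`, `x ≠ 0`:
`ord_{s=1} L = 1`, rank `1`, `Ш[2^∞] = 0`, and `BSD(E_n, 2) ⟺ ord₂ x = 4` — the `2`-Selmer input a tree theorem.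
CONDITIONAL on `hGZK`; nothing asserted. [cite: HeathBrown1994SelmerCongruentII, Appendix (Monsky), typescript p. 41 L20–L36]
[cite: SilvermanAEC2009, Prop. X.1.4, Prop. X.4.9, Thm. X.4.2] [cite: Miller2011LMS, Def. 1.1 (arXiv:1010.2431 p. 3)] -/
theorem rankOne_sha_bsdp_two_iff_congruentNumberCurve_two_mul_three_primes_descent
    (hGZK : rank_eq_analyticRank_of_analyticRank_le_one)
    (p : Fin 3 → ℕ) (hp : ∀ i, (p i).Prime) (hinj : Function.Injective p) {n : ℕ}
    (hn : 2 * ∏ i, p i = n) (h8 : n % 8 = 6) (hs : monskySelmerRankEven p = 1) {x : ℚ}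
    (hx0 : x ≠ 0)
    (hx : deriv (congruentNumberCurve n).entireLFunction 1 =
      (x : ℂ) * ((congruentNumberCurve n).realPeriodRat : ℂ) *
        ((congruentNumberCurve n).regulator : ℂ)) :
    (congruentNumberCurve n).analyticRank = 1 ∧ (congruentNumberCurve n).mordellWeilRank = 1 ∧
      AddCommGroup.primaryComponent (congruentNumberCurve n).sha 2 = ⊥ ∧
      (BSDp (congruentNumberCurve n) 2 ↔ padicValRat 2 x = 4) := by
  have h := rankOne_sha_bsdp_two_iff_congruentNumberCurve_two_mul_prod_descent p hGZK hp hinj hn h8 hs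
    hx0 hx
  norm_num at h
  exact h

/-- **THE EVEN `ℓ = 3` DOOR, `(p, q, r)` form, binder `hGZK` ONLY.** For pairwise distinct primes `p, q, r` with
`2pqr ≡ 6 (mod 8)`, `monskySelmerRankEven ![p, q, r] = 1`, and ANY rank-one datum `L′(E_{2pqr}, 1) = x·Ω·Reg`, `x ≠ 0`:
`ord_{s=1} L = 1`, rank `1`, `Ш[2^∞] = 0`, and `BSD(E_{2pqr}, 2) ⟺ ord₂ x = 4` — the `2`-Selmer input a tree theorem.
CONDITIONAL on `hGZK`; nothing asserted. [cite: HeathBrown1994SelmerCongruentII, Appendix (Monsky), typescript p. 41 L20–L36]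
[cite: SilvermanAEC2009, Prop. X.1.4, Prop. X.4.9, Thm. X.4.2] [cite: Miller2011LMS, Def. 1.1 (arXiv:1010.2431 p. 3)] -/
theorem rankOne_sha_bsdp_two_iff_congruentNumberCurve_two_mul_pqr_descent
    (hGZK : rank_eq_analyticRank_of_analyticRank_le_one)
    {p q r : ℕ} (hp : p.Prime) (hq : q.Prime) (hr : r.Prime) (hpq : p ≠ q) (hpr : p ≠ r)
    (hqr : q ≠ r) (h8 : 2 * (p * q * r) % 8 = 6) (hs : monskySelmerRankEven ![p, q, r] = 1)
    {x : ℚ} (hx0 : x ≠ 0)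
    (hx : deriv (congruentNumberCurve (2 * (p * q * r))).entireLFunction 1 =
      (x : ℂ) * ((congruentNumberCurve (2 * (p * q * r))).realPeriodRat : ℂ) *
        ((congruentNumberCurve (2 * (p * q * r))).regulator : ℂ)) :
    (congruentNumberCurve (2 * (p * q * r))).analyticRank = 1 ∧
      (congruentNumberCurve (2 * (p * q * r))).mordellWeilRank = 1 ∧
      AddCommGroup.primaryComponent (congruentNumberCurve (2 * (p * q * r))).sha 2 = ⊥ ∧
      (BSDp (congruentNumberCurve (2 * (p * q * r))) 2 ↔ padicValRat 2 x = 4) := by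
  have ht : ∀ i, (![p, q, r] i).Prime := fun i => by fin_cases i <;> assumption
  have hinj : Function.Injective ![p, q, r] := by
    intro i j h
    fin_cases i <;> fin_cases j <;> simp_all
  have hn : 2 * ∏ i, ![p, q, r] i = 2 * (p * q * r) := by rw [Fin.prod_univ_three]; rfl
  exact rankOne_sha_bsdp_two_iff_congruentNumberCurve_two_mul_three_primes_descent hGZK _ ht hinj hn h8 hs
    hx0 hx

end ThreePrimes

end Summit.BirchSwinnertonDyer.Rank1Residual.P2

end
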